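/-
Copyright (c) 2026 the pub-hodgecm-mathlib formalisation cell (harness21).  Prover seat hodgecm-mathlib-K2E5-p07 (g2): Track B «K2-LIT», engine E5 «TamagawaUnitary»,
unit G «ZETA», bonus socket G8 `Zeta.sig_K2E5QuatLocalZetaAtOne` :233 — THE PAYER (G8 lead K2E5-p07 (g2); organs (G8-i), (G8-iii) by K2E5-p19 (g2)).
-/
import Summits.HodgeConjecture.HodgeConjecture.Theorems.K2E5QuatLocalZetaAtOne        -- ★ (this seat) p856723: `quatLocalZetaAtOne_of : hmod → hnull → ‹G8›` (over ★ (G8-ii) p856664∕p856693)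
import Summits.HodgeConjecture.HodgeConjecture.Theorems.K2E5QuatLocalLeftMulModule   -- ★ (G8-i) p856698 (K2E5-p19 (g2)): `addHaar_image_leftMul` (module of left multiplication on `D_v`)
import Summits.HodgeConjecture.HodgeConjecture.Theorems.K2E5QuatLocalNullCone        -- ★ (G8-iii) p856724 (K2E5-p19 (g2)): `addHaar_nonunits_eq_zero` (the null cone)
import HarnessLib

/-!
# K2 ∕ E5 «TamagawaUnitary», unit G — SOCKET G8 PAID: `K2E5QuatLocalZetaAtOneHead` («`d^×x_v = dx_v ∕ ‖x‖_v`» and the local zeta factor at `s = 1`)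

Cell `hodgecm-mathlib` (Track B «K2-LIT»), item h413 = `stmt-HodgeConjecture-24833`, route of record `route-HodgeConjecture-HCCMUnconditional`;
bonus socket G8 `…Cruxes.H413.K2E5TamagawaUnitary.Zeta.sig_K2E5QuatLocalZetaAtOne` (:233 of `Cruxes/H413/Lines/K2_E5_TamagawaUnitary_Zeta.lean`, K2E5-plan (g2); bytes frozen since
ED.2 71be4c7b2041), dealt 2026-09-04T01:48:40Z (lead K2E5-p07 (g2), second hand K2E5-p19 (g2)).  PROOF lane (one theorem, no `def` ∕ `instance` ∕ `notation` ∕ named fact ∕ `sorry`),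
`--supports stmt-HodgeConjecture-24833 --as helper`.  Per the cell protocol the `Lines` module is NOT imported: the TYPE of `quatLocalZetaAtOne` is the socket statement token for token
(same `open`s; kernel tie at home `K2/K2E5-p07/g2/ProbePayerG8.lean`: `… : type_of% @sig_copy_G8` with the socket pasted).

STATEMENT.  For a hermitian non-degenerate plane `h` over the CM field `L` and a finite place `v` of `L⁺` (`D_v = quatLocal`, `ι : (D_v)^× ↪ D_v`, `‖·‖_v = quatLocalModule`,
`dx_v = quatLocalAddHaar` with `dx_v(Λ_v) = vol(Λ_v) = quatLocalVol`, `d^×x_v = quatLocalMulHaar` with `d^×x_v(Λ_v^×) = ρ^D_v`): (a) `ι_*(‖·‖_v · d^×x_v) = dx_v`;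
(b) `Z_v(1_{Λ_v}, 1; d^×x_v) = vol(Λ_v)`; (c) `Z_v(1_{Λ_v}, σ; d^×x_v) → vol(Λ_v)` as `σ → 1⁺`.

PROOF = ★ `K2E5QuatLocalZetaAtOne.quatLocalZetaAtOne_of` (this seat: (G8-ii) `d^×x_v = (ι^* dx_v)∕‖·‖_v` by left invariance + Haar uniqueness + the mass count
`dx_v(Λ_v^×) = [Λ_v^× : Λ_v^×(2p)]·vol(B_v) = ρ^D_v`; then (a) by `ι_* ι^* dx_v = dx_v` off a null set, (b) by `dx_v(Λ_v) = vol(Λ_v)`, (c) by dominated convergence) with its two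
hypotheses discharged BY NAME: the module law `hmod := K2E5QuatLocalLeftMulModule.addHaar_image_leftMul` (K2E5-p19 (g2): descent splitting `M₂(E_v) ≃ₜ+ D_v × D_v`, Haar characters
multiply, column Jacobian per `w ∣ v`) and the null cone `hnull := K2E5QuatLocalNullCone.addHaar_nonunits_eq_zero` (K2E5-p19 (g2): `det` in ★ [J1] coordinates is a non-zero polynomial per
`w ∣ v`; polynomial zero loci are Haar-null).

HONEST LABEL: HC_CM is proved only modulo the 7 printed citations (2 remaining named inputs: hLiu418 = stmt-HodgeConjecture-24832, h413 = stmt-HodgeConjecture-24833)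
until rung 0 closes; G8 is a BONUS socket of unit G (not on the G0D road): this file is a count-neutral helper and closes no item.

## References
* [VignerasLNM800] M.-F. Vignéras, *Arithmétique des algèbres de quaternions*, LNM 800 (1980) — Ch. II §4 («dx* = ‖x‖⁻¹dx»; Lemme 4.6 `vol(𝒪_v)`), Ch. III §2.
* [WeilBNT1967] A. Weil, *Basic Number Theory* (1967) — Ch. VII §4 (local zeta factors at `s = 1`), Ch. X §1.
* [TateThesis1967] J. Tate, *Fourier analysis in number fields and Hecke's zeta-functions*, in Cassels–Fröhlich (1967) — §2.4.
-/

set_option autoImplicit false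
set_option linter.dupNamespace false

noncomputable section

namespace Summit.HodgeConjecture.HodgeConjecture.Cruxes.H413.K2E5QuatLocalZetaAtOneHead

open NumberField IsDedekindDomain MeasureTheory MeasureTheory.Measure TopologicalSpace Topology Filter
open Literature.NumberTheory.Automorphic Literature.NumberTheory.Automorphic.UnitaryGroup
open Literature.NumberTheory.Weil1982.UnitaryFinTopForm
open Summit.HodgeConjecture.HodgeConjecture.Cruxes.H413.K2E5QuatLocalMeasure
open Summit.HodgeConjecture.HodgeConjecture.Cruxes.H413.K2E5QuatLocalZeta
open scoped Matrix MatrixGroups NNReal ENNReal Pointwise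

/-- **SOCKET G8 `Zeta.sig_K2E5QuatLocalZetaAtOne` — PAID, statement token for token.**  For a hermitian non-degenerate plane `h` over a CM field `L` and a finite place `v` of `L⁺`:
(a) pushing `‖x‖_v · d^×x_v` forward along `(D_v)^× ↪ D_v` gives the self-dual additive Haar measure `dx_v` («`d^×x_v = dx_v ∕ ‖x‖_v`»); (b) the standard local zeta factor at `s = 1`
is the volume of the order, `Z_v(1_{Λ_v}, 1; d^×x_v) = vol(Λ_v)`; (c) `Z_v(1_{Λ_v}, σ; d^×x_v) → vol(Λ_v)` as `σ → 1⁺`.  Proof: ★ `quatLocalZetaAtOne_of` with `hmod :=` ★ `addHaar_image_leftMul`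
and `hnull :=` ★ `addHaar_nonunits_eq_zero`. [cite: VignerasLNM800, Ch. II §4 (dx^* = ‖x‖⁻¹dx; Lemme 4.6)] [cite: WeilBNT1967, Ch. VII §4 (local zeta at s = 1)] [cite: TateThesis1967, §2.4] -/
theorem quatLocalZetaAtOne :
    ∀ (L : Type) [Field L] [NumberField L] [IsCMField L] (Ha : Matrix (Fin 2) (Fin 2) L)
      (_ : (Ha.map (cmConjRingHom L)).transpose = Ha) (_ : Ha.det ≠ 0) (v : HeightOneSpectrum (𝓞 ↥(maximalRealSubfield L)))
      [MeasurableSpace (Matrix (Fin 2) (Fin 2) (LocalRing L v))] [BorelSpace (Matrix (Fin 2) (Fin 2) (LocalRing L v))]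
      [MeasurableSpace (GL (Fin 2) (LocalRing L v))] [BorelSpace (GL (Fin 2) (LocalRing L v))],
    Measure.map (fun x : ↥(quatLocalUnits L Ha v) =>
        (⟨(x : GL (Fin 2) (LocalRing L v)).val, (mem_quatLocalUnits_iff L Ha v (x : GL (Fin 2) (LocalRing L v))).1 x.2⟩ : ↥(quatLocal L Ha v)))
        ((quatLocalMulHaar L Ha v).withDensity fun x => ((quatLocalModule L Ha v x : ℝ≥0) : ℝ≥0∞))
      = quatLocalAddHaar L Ha v ∧
    quatLocalStdZeta L Ha v (quatLocalMulHaar L Ha v) 1 = ((quatLocalVol L Ha v : ℝ) : ℂ) ∧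
    Tendsto (fun σ : ℝ => quatLocalStdZeta L Ha v (quatLocalMulHaar L Ha v) (σ : ℂ)) (𝓝[>] (1 : ℝ)) (𝓝 ((quatLocalVol L Ha v : ℝ) : ℂ)) :=
  K2E5QuatLocalZetaAtOne.quatLocalZetaAtOne_of
    (fun L _ _ _ Ha hHa hdet v _ _ μ _ g s => K2E5QuatLocalLeftMulModule.addHaar_image_leftMul L Ha hHa hdet v μ g s)
    (fun L _ _ _ Ha hHa hdet v _ _ μ _ => K2E5QuatLocalNullCone.addHaar_nonunits_eq_zero L Ha hHa hdet v μ)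

end Summit.HodgeConjecture.HodgeConjecture.Cruxes.H413.K2E5QuatLocalZetaAtOneHead

end
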